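import Summits.Ventures.HSemireg.AmplificationChainVersalChart
import HarnessLib

/-!
# Venture HSemireg — SATISFIABILITY WITNESS for the versal-chart predicate `HasVersalPerfectChartAt`

HONEST FRAMING. Lean index of the computation cell `pub-hsemireg` (theory seat 3). Nothing about any explicit variety is
asserted; nothing here says HC, HC_CM or HC_AV is proved. Theorems only (0 `def`, 0 `sorry`, no new axiom, no named fact).
For the red team's vacuity lens (RED-1 v22, WITNESS-GAP (2)): the predicate `HasVersalPerfectChartAt π s₀ X₀ e E` of
`AmplificationChainVersalChart.lean` (the Lieblich-type chart input of rungs R3/R4 and of the EGA-free rung) is INHABITED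
in the tautological situation — a bounded complex of vector bundles that extends GLOBALLY over `𝒳` satisfies it with
`V = S`, `f = 𝟙_S`, `v₀ = s₀`, `𝒱 = pr_𝒳^* ℱ`, the canonical fibre identification and the identity roof (sister of
`perfectComplexExtendsOverEtaleNbhdAt_of_global`, the witness for rung R2's predicate); and, with NO hypothesis at all, on every family
at every point for the structure sheaf in degree `0` (`hasVersalPerfectChartAt_unit`, via `isFiniteLocallyFree_unit`).

READING NOTE (precision on what the predicate's last clause says). The VERSALITY clause of `HasVersalPerfectChartAt`
is typed in EXISTENCE form: from a `B`-point `b` of `V` centred at `v₀` over an `A`-point `a` of `S` and a bounded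
complex of vector bundles `G` on `X_A` restricting to `gB^*𝒱` in `D(Mod 𝒪_{X_B})`, it asks for an `A`-point `a′`
of `V` through `b` over `a` — NOT, in addition, for an identification `G ≃ a′^*𝒱`. This is exactly what the glue
`perfectLiftsAlgebraise_of_versalCharts` consumes (the infinitesimal lifting criterion for `V → S` at `v₀`), it is
IMPLIED BY (hence weaker than) formal smoothness at `v₀` of a Lieblich atlas `V → 𝒟^b_{pug}(𝒳/S)`, and it is why
the global witness below is immediate: with `V = S` the point `a′ := a` serves, whatever `G` is. The witness therefore
shows the predicate is satisfiable as typed; it does not exhibit a versal family in Lieblich's sense. [folklore]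
-/

noncomputable section

open CategoryTheory CategoryTheory.Limits AlgebraicGeometry
open Literature.AlgebraicGeometry.Motives Literature.AlgebraicGeometry.HodgeTheory
open Literature.AlgebraicGeometry.KTheory

namespace Summit.Ventures.HSemireg

/-! ## NON-VACUITY WITNESS: a complex that extends GLOBALLY over `𝒳` has a (tautological) versal chart `V = S` -/

section Witness

/-- **Satisfiability witness for `HasVersalPerfectChartAt`**: if `E` is (on the nose) the restriction to
`X₀ = 𝒳_{s₀}` of a bounded complex of vector bundles `ℱ` on `𝒳` itself, the predicate holds with `V = S`,
`f = 𝟙_S` (locally of finite type), `v₀ = s₀`, `𝒱 = pr_𝒳^* ℱ` on `𝒳 ×_S S`, `εV` the canonical identification,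
the identity roof, and — the versality clause being typed in existence form — `a′ := a` for every test diagram
(`b ≫ 𝟙 = Spec φ ≫ a` is the hypothesis `hsq`). [folklore] -/
theorem hasVersalPerfectChartAt_of_global {𝒳 S : SchemeOver ℂ} (π : 𝒳 ⟶ S) (s₀ : ComplexPoints S)
    (ℱ : CochainComplex 𝒳.left.Modules ℤ) (hℱ : IsBoundedVBComplex ℱ) :
    HasVersalPerfectChartAt π s₀ (fiberOver π s₀) (Iso.refl _)
      (((Scheme.Modules.pullback (fiberι π s₀).left).mapHomologicalComplex (ComplexShape.up ℤ)).obj ℱ) := by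
  have hT : LocallyOfFiniteType (𝟙 S : S ⟶ S).left := by
    rw [Over.id_left]
    infer_instance
  -- εV : 𝒳_{s₀} ≅ (𝒳 ×_S S)_{s₀} is the inverse of the canonical fibre identification (at the point 𝟙(s₀) = s₀)
  let ε : fiberOver π s₀ ≅ fiberOver (familyPullback.snd π (𝟙 S)) s₀ :=
    (fiberOverFamilyPullbackIso π (𝟙 S) s₀ ≪≫ eqToIso (congrArg (fiberOver π) (AlgPoints.map_id_apply s₀))).symm
  have hε : ε.hom ≫ fiberι (familyPullback.snd π (𝟙 S)) s₀ ≫ familyPullback.fst π (𝟙 S) =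
      (Iso.refl _).hom ≫ fiberι π s₀ := by
    change ((fiberOverFamilyPullbackIso π (𝟙 S) s₀ ≪≫
        eqToIso (congrArg (fiberOver π) (AlgPoints.map_id_apply s₀))).inv) ≫ _ ≫ _ = _
    rw [Iso.trans_inv, eqToIso.inv, Category.assoc, ← fiberOverFamilyPullbackIso_hom_fiberι π (𝟙 S) s₀,
      Iso.inv_hom_id_assoc, Iso.refl_hom, Category.id_comp]
    exact eqToHom_comp_fiberι' π (AlgPoints.map_id_apply s₀).symm
  -- the restriction of `pr_𝒳^* ℱ` along `εV ≫ ι_{s₀}` is TERMWISE the restriction of `ℱ` along `ι_{s₀}`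
  let 𝒱 := ((Scheme.Modules.pullback (familyPullback.fst π (𝟙 S)).left).mapHomologicalComplex (ComplexShape.up ℤ)).obj ℱ
  have hcomp : (ε.hom ≫ fiberι (familyPullback.snd π (𝟙 S)) s₀).left ≫ (familyPullback.fst π (𝟙 S)).left =
      (fiberι π s₀).left := by
    rw [← Over.comp_left, Category.assoc, hε, Over.comp_left, Iso.refl_hom, Over.id_left, Category.id_comp]
  let ι : ((Scheme.Modules.pullback (fiberι π s₀).left).mapHomologicalComplex (ComplexShape.up ℤ)).obj ℱ ≅
      ((Scheme.Modules.pullback (ε.hom ≫ fiberι (familyPullback.snd π (𝟙 S)) s₀).left).mapHomologicalComplex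
        (ComplexShape.up ℤ)).obj 𝒱 :=
    (NatIso.mapHomologicalComplex (Scheme.Modules.pullbackCongr hcomp.symm ≪≫
      (Scheme.Modules.pullbackComp (ε.hom ≫ fiberι (familyPullback.snd π (𝟙 S)) s₀).left
        (familyPullback.fst π (𝟙 S)).left).symm) (ComplexShape.up ℤ)).app ℱ
  refine ⟨S, 𝟙 S, hT, s₀, AlgPoints.map_id_apply s₀, 𝒱, hℱ.pullback _, ε, hε, _, hℱ.pullback _, ι.hom, 𝟙 _,
    ⟨inferInstance, inferInstance⟩, ?_⟩
  -- VERSALITY (existence form): over `V = S` the `A`-point `a` itself lies over `a` and restricts to `b`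
  intro _ _ _ _ _ _ _ _ _ _ _ _ a _ _ hsq _ _ _ _ _ _ _ _ _ _ _ _ _ _
  refine ⟨a, ?_, Category.comp_id a⟩
  rw [Over.id_left, Category.comp_id] at hsq
  exact hsq.symm

end Witness

/-! ## AN UNCONDITIONAL INSTANCE: the structure sheaf `𝒪_{𝒳_{s₀}} = ι_{s₀}^* 𝒪_𝒳` in degree `0`, on ANY family -/

section Instance

universe u in
/-- The structure sheaf `𝒪_Y` (Mathlib `SheafOfModules.unit`, `= free PUnit` up to `coproductUniqueIso`) is finite
locally free (tree `KZero.isFiniteLocallyFree_free`). [folklore] -/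
theorem isFiniteLocallyFree_unit {Y : Scheme.{u}} :
    IsFiniteLocallyFree (SheafOfModules.unit Y.ringCatSheaf : Y.Modules) :=
  Literature.AlgebraicGeometry.Modules.isFiniteLocallyFree_of_iso
    (coproductUniqueIso (fun _ : PUnit.{u + 1} => (SheafOfModules.unit Y.ringCatSheaf : Y.Modules)))
    (KZero.isFiniteLocallyFree_free PUnit)

/-- **`HasVersalPerfectChartAt` is INHABITED on every family at every point, with no hypothesis**: the complex
`ι_{s₀}^* (𝒪_𝒳[0])` (the structure sheaf of the fibre in degree `0`, written as a restriction) on `X₀ = 𝒳_{s₀}` has the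
tautological chart `V = S` of `hasVersalPerfectChartAt_of_global`. [folklore] -/
theorem hasVersalPerfectChartAt_unit {𝒳 S : SchemeOver ℂ} (π : 𝒳 ⟶ S) (s₀ : ComplexPoints S) :
    HasVersalPerfectChartAt π s₀ (fiberOver π s₀) (Iso.refl _)
      (((Scheme.Modules.pullback (fiberι π s₀).left).mapHomologicalComplex (ComplexShape.up ℤ)).obj
        ((HomologicalComplex.single 𝒳.left.Modules (ComplexShape.up ℤ) 0).obj
          (SheafOfModules.unit 𝒳.left.ringCatSheaf : 𝒳.left.Modules))) :=
  hasVersalPerfectChartAt_of_global π s₀ _ (IsBoundedVBComplex.single _ isFiniteLocallyFree_unit 0)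

end Instance

end Summit.Ventures.HSemireg

end
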